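import Mathlib
import Summits.ValiantsHypothesis.ValiantsHypothesis.Theorems.GrenetZeonTwoDimCoefficientsScalingCodimHalfPerGenericity

/-!
# Crux `GrenetZeon.TwoDimCoefficients` (stmt-ValiantsHypothesis-8062) / rung `DualUnipotentThreeHalves` (stmt-24318):
# scaling-closure — PG(k < n), SHARP: EVERY SUBSPACE OF `M_n(ℂ)` OF CODIMENSION `< n` CONTAINS A FULL-RANK POINT OF `Hess per_n`

Sharpening of ✓ PG(k ≤ n/2) (`exists_mem_fullRank_hess0_perPoly_of_codim_le_half`, p837688) to the optimal range: the
Hessian-degeneracy locus of the permanent contains no linear subspace of codimension `< n`, while the König subspace `{row i = 0}`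
(codimension `n`) has Hessian rank `≤ 2n` everywhere.  The only new ingredient is combinatorial:

* ★ `exists_orders_lt_of_card_lt` — fewer than `N` cells of an `N × N` grid can be made simultaneously STRICTLY UPPER by a row
  order and a column order (induction: an edge-free column goes first, a row carrying a cell goes first among rows, recurse);
* `exists_perms_lt_of_card_lt` — the same for `Fin n × Fin n` with permutations;
* ★★★ `exists_mem_fullRank_hess0_perPoly_of_codim_lt` — `∀ V ≤ M_n(ℂ)`, `n² ≤ finrank V + k`, `k < n`, `2 ≤ n` ⇒
  `∃ z ∈ V, rank Hess per_n(z) = n²` (supplementing cells ✓ + orders + unitriangular family ✓ p837494).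

Consequence for T4 (✓ p836227 / p837847): index-reducing substitutions of corank `< n` need no per-genericity clause.

HONEST FRAMING: an unconditional, route-independent theorem about the permanent (no Theses import); INDEX-COST, the stub
`DualUnipotentBound`, crux 8062, the 24318 decl and `VP ≠ VNP` remain open.

References: T. Mignon, N. Ressayre, Int. Math. Res. Not. 2004:79, §3 (via the tree); folklore.
-/

-- single-conjunct layout `Summits/ValiantsHypothesis/ValiantsHypothesis`: the duplicated namespace
-- component is mandated by the tree.
set_option linter.dupNamespace false
set_option autoImplicit false

noncomputable section

namespace Summit.ValiantsHypothesis.ValiantsHypothesis.Theorems.GrenetZeonTwoDimCoefficients.ScalingClosure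

open MvPolynomial Matrix
open Literature.Computability.AlgebraicComplexity

section CodimLt

/-- ★ **Fewer than `N` cells can be made strictly upper.**  For finite sets of rows `R` and columns `C` of size `N` and a set
`T ⊆ R × C` of fewer than `N` cells there are numberings `f : R ↪ {0..N−1}`, `g : C ↪ {0..N−1}` with `f r < g c` for every cell
`(r, c) ∈ T`.  (Induction on `N`: a column without cells gets `0`, a row with a cell gets `0`, recurse on the rest.) [folklore] -/
theorem exists_orders_lt_of_card_lt {α β : Type*} [DecidableEq α] [DecidableEq β] :
    ∀ (N : ℕ) (R : Finset α) (C : Finset β) (T : Finset (α × β)), T ⊆ R ×ˢ C → R.card = N → C.card = N →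
      T.card < N ∨ T = ∅ →
      ∃ (f : α → ℕ) (g : β → ℕ), Set.InjOn f R ∧ Set.InjOn g C ∧ (∀ r ∈ R, f r < N) ∧ (∀ c ∈ C, g c < N) ∧
        ∀ p ∈ T, f p.1 < g p.2 := by
  intro N
  induction N with
  | zero =>
    intro R C T hT hR hC _
    have hR0 : R = ∅ := Finset.card_eq_zero.mp hR
    have hT0 : T = ∅ := by
      rw [Finset.eq_empty_iff_forall_notMem]
      intro p hp
      have := hT hp
      rw [hR0, Finset.empty_product] at this
      exact absurd this (Finset.notMem_empty _)
    refine ⟨fun _ => 0, fun _ => 0, ?_, ?_, ?_, ?_, ?_⟩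
    · intro a ha; rw [hR0] at ha; exact absurd ha (Finset.notMem_empty _)
    · intro a ha b hb _
      have hC0 : C = ∅ := Finset.card_eq_zero.mp hC
      rw [hC0] at ha; exact absurd ha (Finset.notMem_empty _)
    · intro r hr; rw [hR0] at hr; exact absurd hr (Finset.notMem_empty _)
    · intro c hc
      have hC0 : C = ∅ := Finset.card_eq_zero.mp hC
      rw [hC0] at hc; exact absurd hc (Finset.notMem_empty _)
    · intro p hp; rw [hT0] at hp; exact absurd hp (Finset.notMem_empty _)
  | succ N ih =>
    intro R C T hT hR hC hcard
    -- a column carrying no cell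
    have hcolcard : (T.image Prod.snd).card < C.card := by
      rw [hC]
      rcases hcard with h | h
      · exact lt_of_le_of_lt Finset.card_image_le h
      · rw [h, Finset.image_empty, Finset.card_empty]; exact Nat.succ_pos N
    obtain ⟨c₀, hc₀C, hc₀⟩ := Finset.exists_mem_notMem_of_card_lt_card hcolcard
    have hc₀free : ∀ p ∈ T, p.2 ≠ c₀ := by
      intro p hp hpc
      exact hc₀ (Finset.mem_image.mpr ⟨p, hp, hpc⟩)
    -- a row: one carrying a cell if there is any
    have hRne : R.Nonempty := by rw [← Finset.card_pos, hR]; exact Nat.succ_pos N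
    obtain ⟨r₀, hr₀R, hr₀⟩ : ∃ r₀ ∈ R, (T ≠ ∅ → ∃ p ∈ T, p.1 = r₀) := by
      by_cases hT0 : T = ∅
      · obtain ⟨r, hr⟩ := hRne
        exact ⟨r, hr, fun h => absurd hT0 h⟩
      · obtain ⟨p₀, hp₀⟩ := Finset.nonempty_iff_ne_empty.mpr hT0
        exact ⟨p₀.1, (Finset.mem_product.mp (hT hp₀)).1, fun _ => ⟨p₀, hp₀, rfl⟩⟩
    -- the reduced instance
    set R' := R.erase r₀ with hR'
    set C' := C.erase c₀ with hC'
    set T' := T.filter (fun p => p.1 ≠ r₀) with hT'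
    have hR'card : R'.card = N := by rw [hR', Finset.card_erase_of_mem hr₀R, hR]; rfl
    have hC'card : C'.card = N := by rw [hC', Finset.card_erase_of_mem hc₀C, hC]; rfl
    have hT'sub : T' ⊆ R' ×ˢ C' := by
      intro p hp
      rw [hT', Finset.mem_filter] at hp
      have hpRC := Finset.mem_product.mp (hT hp.1)
      rw [Finset.mem_product, hR', hC', Finset.mem_erase, Finset.mem_erase]
      exact ⟨⟨hp.2, hpRC.1⟩, ⟨hc₀free p hp.1, hpRC.2⟩⟩
    have hT'card : T'.card < N ∨ T' = ∅ := by
      by_cases hT0 : T = ∅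
      · right
        rw [hT', hT0, Finset.filter_empty]
      · left
        obtain ⟨p₀, hp₀, hp₀r⟩ := hr₀ hT0
        have hlt : T'.card < T.card := by
          apply Finset.card_lt_card
          refine ⟨Finset.filter_subset _ _, fun hsub => ?_⟩
          have := Finset.mem_filter.mp (hsub hp₀)
          exact this.2 hp₀r
        have := hcard.resolve_right hT0
        omega
    obtain ⟨f', g', hf', hg', hfN, hgN, hfg⟩ := ih R' C' T' hT'sub hR'card hC'card hT'card
    refine ⟨fun r => if r = r₀ then 0 else f' r + 1, fun c => if c = c₀ then 0 else g' c + 1, ?_, ?_, ?_, ?_, ?_⟩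
    · intro a ha b hb hab
      dsimp only at hab
      by_cases ha0 : a = r₀
      · by_cases hb0 : b = r₀
        · rw [ha0, hb0]
        · rw [if_pos ha0, if_neg hb0] at hab; omega
      · by_cases hb0 : b = r₀
        · rw [if_neg ha0, if_pos hb0] at hab; omega
        · rw [if_neg ha0, if_neg hb0] at hab
          exact hf' (Finset.mem_erase.mpr ⟨ha0, ha⟩) (Finset.mem_erase.mpr ⟨hb0, hb⟩) (by omega)
    · intro a ha b hb hab
      dsimp only at hab
      by_cases ha0 : a = c₀
      · by_cases hb0 : b = c₀
        · rw [ha0, hb0]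
        · rw [if_pos ha0, if_neg hb0] at hab; omega
      · by_cases hb0 : b = c₀
        · rw [if_neg ha0, if_pos hb0] at hab; omega
        · rw [if_neg ha0, if_neg hb0] at hab
          exact hg' (Finset.mem_erase.mpr ⟨ha0, ha⟩) (Finset.mem_erase.mpr ⟨hb0, hb⟩) (by omega)
    · intro r hr
      dsimp only
      by_cases h0 : r = r₀
      · rw [if_pos h0]; omega
      · rw [if_neg h0]
        have := hfN r (Finset.mem_erase.mpr ⟨h0, hr⟩)
        omega
    · intro c hc
      dsimp only
      by_cases h0 : c = c₀
      · rw [if_pos h0]; omega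
      · rw [if_neg h0]
        have := hgN c (Finset.mem_erase.mpr ⟨h0, hc⟩)
        omega
    · intro p hp
      dsimp only
      rw [if_neg (hc₀free p hp)]
      by_cases h0 : p.1 = r₀
      · rw [if_pos h0]; omega
      · rw [if_neg h0]
        have := hfg p (Finset.mem_filter.mpr ⟨hp, h0⟩)
        omega

/-- **Permutation form** on `Fin n × Fin n`: fewer than `n` cells are simultaneously strictly upper for some row permutation `ρ`
and column permutation `κ`. [folklore] -/
theorem exists_perms_lt_of_card_lt {n : ℕ} (T : Finset (Fin n × Fin n)) (hT : T.card < n) :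
    ∃ ρ κ : Equiv.Perm (Fin n), ∀ p ∈ T, (ρ p.1).val < (κ p.2).val := by
  classical
  obtain ⟨f, g, hf, hg, hfN, hgN, hfg⟩ := exists_orders_lt_of_card_lt (α := Fin n) (β := Fin n) n Finset.univ
    Finset.univ T (fun p _ => Finset.mem_product.mpr ⟨Finset.mem_univ _, Finset.mem_univ _⟩)
    (by rw [Finset.card_univ, Fintype.card_fin]) (by rw [Finset.card_univ, Fintype.card_fin]) (Or.inl hT)
  set F : Fin n → Fin n := fun r => ⟨f r, hfN r (Finset.mem_univ _)⟩ with hF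
  set G : Fin n → Fin n := fun c => ⟨g c, hgN c (Finset.mem_univ _)⟩ with hG
  have hFinj : Function.Injective F := fun a b hab =>
    hf (Finset.mem_univ a) (Finset.mem_univ b) (by simpa [hF] using congrArg Fin.val hab)
  have hGinj : Function.Injective G := fun a b hab =>
    hg (Finset.mem_univ a) (Finset.mem_univ b) (by simpa [hG] using congrArg Fin.val hab)
  refine ⟨Equiv.ofBijective F (Finite.injective_iff_bijective.mp hFinj),
    Equiv.ofBijective G (Finite.injective_iff_bijective.mp hGinj), fun p hp => ?_⟩
  rw [Equiv.ofBijective_apply, Equiv.ofBijective_apply]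
  exact hfg p hp

/-- ★★★ **PG(k < n), sharp: every linear subspace of `M_n(ℂ)` of codimension `< n` contains a point at which the Hessian of `per_n`
has full rank `n²`** (`n ≥ 2`).  The König subspaces `{row i = 0}` (codimension `n`, Hessian rank `≤ 2n`) show that `n` cannot be
replaced by `n + 1`. [cite: MignonRessayre2004, §3 — via the tree; folklore] -/
theorem exists_mem_fullRank_hess0_perPoly_of_codim_lt {n : ℕ} (hn : 2 ≤ n) (V : Submodule ℂ (Fin n × Fin n → ℂ))
    (k : ℕ) (hV : n ^ 2 ≤ Module.finrank ℂ V + k) (hk : k < n) :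
    ∃ z ∈ V, (hess0 (transl z (perPoly (Fin n) ℂ))).rank = n ^ 2 := by
  classical
  -- (i) supplementing cells
  obtain ⟨S, hScard, hS⟩ := exists_cells_sup_span_eq_top (X := Fin n × Fin n) k V
    (by rw [Fintype.card_prod, Fintype.card_fin, ← sq]; exact hV)
  -- (ii) orders making every cell of `S` strictly upper
  obtain ⟨ρ, κ, hSU⟩ := exists_perms_lt_of_card_lt S (lt_of_le_of_lt hScard hk)
  -- (iii) decompose the permutation point `P_{τ₀}`, `τ₀ = ρ⁻¹ κ`
  set P : Fin n × Fin n → ℂ := fun u => if ρ u.1 = κ u.2 then 1 else 0 with hPdef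
  have hPmem : P ∈ V ⊔ Submodule.span ℂ ((fun p : Fin n × Fin n => (Pi.single p (1 : ℂ) : _ → ℂ)) '' ↑S) := by
    rw [hS]; exact Submodule.mem_top
  obtain ⟨v, hv, u, hu, hvu⟩ := Submodule.mem_sup.mp hPmem
  have hu0 : ∀ q ∉ S, u q = 0 := fun q hq => eq_zero_of_mem_span_single S hu hq
  have hvz : v = fun q : Fin n × Fin n =>
      if ρ q.1 = κ q.2 then (1 : ℂ) else if (ρ q.1).val < (κ q.2).val then (fun q => -u q) q else 0 := by
    funext q
    have hq : v q = P q - u q := by rw [← hvu]; simp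
    rw [hq, hPdef]
    dsimp only
    by_cases h1 : ρ q.1 = κ q.2
    · have hqS : q ∉ S := fun hqS => by have := hSU q hqS; rw [h1] at this; exact lt_irrefl _ this
      rw [if_pos h1, if_pos h1, hu0 q hqS, sub_zero]
    · rw [if_neg h1, if_neg h1]
      by_cases h2 : (ρ q.1).val < (κ q.2).val
      · rw [if_pos h2, zero_sub]
      · have hqS : q ∉ S := fun hqS => h2 (hSU q hqS)
        rw [if_neg h2, hu0 q hqS, sub_zero]
  refine ⟨v, hv, ?_⟩
  rw [hvz]
  exact rank_hess0_transl_unitri_perPoly hn ρ κ (fun q => -u q)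

end CodimLt

end Summit.ValiantsHypothesis.ValiantsHypothesis.Theorems.GrenetZeonTwoDimCoefficients.ScalingClosure

end
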